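import Summits.Ventures.CertifiedManyBodySolver.Downfold.EmeryShapeTrueCornerBand
import Summits.Ventures.CertifiedManyBodySolver.Downfold.EmeryFermiScalePointsBi2201M61TrueCorners
import Summits.Ventures.CertifiedManyBodySolver.Downfold.EmeryFermiScalePointsBi2201M61VirtualCorners
import HarnessLib

/-!
# THE ONE-BAND FERMI-SURFACE SHAPE `t′/t` OF THE WHOLE TYPED 3BE BOX `emeryBoxBi2201M61MoreePPSrc (EmeryBoxesKSlicesN)` OVER ITS WHOLE FILLING BAND, AT ITS TWO TRUE CORNERS (true-corner rule, band form,
# §B.87 (j); router/EMERY-SHAPE-CORNERS.tsv «true band» rows)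

Venture CertifiedManyBodySolver, cell `pub/hubbard-downfold` (stage S1; INFLATION-RULES-3to1-B §B.87 (j)), seat hubbard-downfold-mod-4 (technique B, g35); namespace
`Summit.Ventures.CertifiedManyBodySolver.Downfold.Emery`. Everything PROVED (0 sorry; no new certificate — the end-filling brackets of the per-filling files are re-read).
WHAT THIS IS NOT: a statement about Bi₂Sr₂CuO₆₊δ (M61; Morée PP source box) — the typed box is SCREENING-GRADE; `U = 0` one-body kinematics of the σ model (rigid band).

For EVERY one-body row of `[1.76, 2.36] × [1.25, 1.47] × [0.62, 0.74] × [0.14, 0.17]` eV AND EVERY filling `ν ∈ [103/250, 107/250]` the one-band `t′/t` lies in **[-0.3143, -0.2482]**: the true-corner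
squeeze `fsRatio_fermiEnergyOf_trueCorner_lower_band` / `…_upper_band` (`EmeryShapeTrueCornerBand`: slab windows `[pL, qL] = [8131/5000, 8673/5000]`, `[pU, qU] = [18223/10000, 769/400]`, regime `qT = 10651/5000`
certified at the END fillings; margin constants lower slab M_b 0.8721 / M_c 0.0, upper slab M_b 3.545 / M_c 0.0), read at the true corners over their band windows
`[3313/2000, 17079/10000]` (monotone) and `[18491/10000, 18891/10000]` (monotone) (`fermiEnergyOf_mem_Icc_of_band`). Comparator (certified, g19 sub-box device, n_H band): [-0.3162,-0.2456] (n_H band).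

Sources: three-band model [HybertsenSchluterChristensen1989, Eq. (1)]; [AndersenEtAl1995, §6]; box rows as cited in the typed object's file.
-/

noncomputable section

namespace Summit.Ventures.CertifiedManyBodySolver.Downfold.Emery

open Real Set

/-- **filling band ν ∈ [103/250, 107/250] (n_H = 1.176 (ν = 103/250) … n_H = 1.144 (ν = 107/250)): for every row of the box AND every filling of the band the one-band Fermi-surface `t′/t` (object E) lies in `[-0.3143, -0.2482]` — between its values at the two TRUE corners** (band form of the true-corner rule; margins by `norm_num`). [folklore] -/
theorem bi2201M61Box_fsRatio_true_band {Δ a b c ν : ℝ} (hΔ : Δ ∈ Icc ((44 : ℝ) / 25) ((59 : ℝ) / 25)) (ha : a ∈ Icc ((5 : ℝ) / 4) ((147 : ℝ) / 100)) (hb : b ∈ Icc ((31 : ℝ) / 50) ((37 : ℝ) / 50)) (hc : c ∈ Icc ((7 : ℝ) / 50) ((17 : ℝ) / 100)) (hν : ν ∈ Icc ((103 : ℝ) / 250) ((107 : ℝ) / 250)) :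
    fsRatio Δ a b c (fermiEnergyOf Δ a b c ν) ∈ Icc ((-3143 : ℝ) / 10000) ((-1241 : ℝ) / 5000) := by
  have hSL := (fermiEnergyOf_of_pointBracketCheck truePt_Bi2201M61SL_nH1176_br (by norm_num) (by norm_num) (by norm_num) (ν := (103/250 : ℝ)) (by push_cast; exact ⟨le_rfl, le_rfl⟩)).2
  have hAlo := (fermiEnergyOf_of_pointBracketCheck virtPt_Bi2201M61Alo_nH1144_br (by norm_num) (by norm_num) (by norm_num) (ν := (107/250 : ℝ)) (by push_cast; exact ⟨le_rfl, le_rfl⟩)).2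
  have hTop := (fermiEnergyOf_of_pointBracketCheck virtPt_Bi2201M61H_nH1144_br (by norm_num) (by norm_num) (by norm_num) (ν := (107/250 : ℝ)) (by push_cast; exact ⟨le_rfl, le_rfl⟩)).2
  have hSU := (fermiEnergyOf_of_pointBracketCheck truePt_Bi2201M61SU_nH1176_br (by norm_num) (by norm_num) (by norm_num) (ν := (103/250 : ℝ)) (by push_cast; exact ⟨le_rfl, le_rfl⟩)).2
  have hQU := (fermiEnergyOf_of_pointBracketCheck truePt_Bi2201M61QU_nH1144_br (by norm_num) (by norm_num) (by norm_num) (ν := (107/250 : ℝ)) (by push_cast; exact ⟨le_rfl, le_rfl⟩)).2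
  have hTL1 := (fermiEnergyOf_of_pointBracketCheck truePt_Bi2201M61TL_nH1176_br (by norm_num) (by norm_num) (by norm_num) (ν := (103/250 : ℝ)) (by push_cast; exact ⟨le_rfl, le_rfl⟩)).2
  have hTL2 := (fermiEnergyOf_of_pointBracketCheck truePt_Bi2201M61TL_nH1144_br (by norm_num) (by norm_num) (by norm_num) (ν := (107/250 : ℝ)) (by push_cast; exact ⟨le_rfl, le_rfl⟩)).2
  have hTH1 := (fermiEnergyOf_of_pointBracketCheck truePt_Bi2201M61TH_nH1176_br (by norm_num) (by norm_num) (by norm_num) (ν := (103/250 : ℝ)) (by push_cast; exact ⟨le_rfl, le_rfl⟩)).2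
  have hTH2 := (fermiEnergyOf_of_pointBracketCheck truePt_Bi2201M61TH_nH1144_br (by norm_num) (by norm_num) (by norm_num) (ν := (107/250 : ℝ)) (by push_cast; exact ⟨le_rfl, le_rfl⟩)).2
  push_cast at hSL hAlo hTop hSU hQU hTL1 hTL2 hTH1 hTH2
  norm_num at hSL hAlo hTop hSU hQU hTL1 hTL2 hTH1 hTH2
  obtain ⟨hΔl, hΔu⟩ := hΔ
  obtain ⟨hal, hau⟩ := ha
  have hTL := fermiEnergyOf_mem_Icc_of_band (Δ := ((44 : ℝ) / 25)) (a := ((5 : ℝ) / 4)) (b := ((37 : ℝ) / 50)) (c := ((17 : ℝ) / 100)) (e₁ := ((3313 : ℝ) / 2000)) (e₂ := ((17079 : ℝ) / 10000)) (by norm_num) (by norm_num) (by norm_num) (by norm_num) (by norm_num) hν (by norm_num) hTL1.1 hTL2.2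
  have hTH := fermiEnergyOf_mem_Icc_of_band (Δ := ((59 : ℝ) / 25)) (a := ((147 : ℝ) / 100)) (b := ((31 : ℝ) / 50)) (c := ((7 : ℝ) / 50)) (e₁ := ((18491 : ℝ) / 10000)) (e₂ := ((18891 : ℝ) / 10000)) (by norm_num) (by norm_num) (by norm_num) (by norm_num) (by norm_num) hν (by norm_num) hTH1.1 hTH2.2
  constructor
  · have hlow := fsRatio_fermiEnergyOf_trueCorner_lower_band (Δ₁ := ((44 : ℝ) / 25)) (a₁ := ((5 : ℝ) / 4)) (b₁ := ((31 : ℝ) / 50)) (b₂ := ((37 : ℝ) / 50)) (c₁ := ((7 : ℝ) / 50)) (c₂ := ((17 : ℝ) / 100)) (ν₁ := ((103 : ℝ) / 250)) (ν₂ := ((107 : ℝ) / 250))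
      (pL := ((8131 : ℝ) / 5000)) (qL := ((8673 : ℝ) / 5000)) (Mb := ((8721 : ℝ) / 10000)) (Mc := (0 : ℝ)) (by norm_num) hΔl (by norm_num) hal (by norm_num) hb (by norm_num) hc (by norm_num) (by norm_num) hν (by norm_num)
      (by norm_num) hSL.1 hAlo.2 (by norm_num) (by norm_num [fsD, fsN]) (by norm_num) (by norm_num) (by norm_num [fsD, fsN]) (by norm_num) (by norm_num [dopingDisc]) (by norm_num [fsD, fsN])
    refine le_trans ?_ hlow
    have hw := (fsRatio_mem_Icc_on_window_of_dopingDisc_nonpos (Δ := ((44 : ℝ) / 25)) (a := ((5 : ℝ) / 4)) (b := ((37 : ℝ) / 50)) (c := ((17 : ℝ) / 100))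
      (p := ((3313 : ℝ) / 2000)) (q := ((17079 : ℝ) / 10000)) (by norm_num) (by norm_num) (by norm_num) (by norm_num) (by norm_num) (by norm_num) (by norm_num) (by norm_num [dopingDisc]) hTL).1
    refine le_trans ?_ hw
    norm_num [fsRatio, fsD, fsN]
  · have hup := fsRatio_fermiEnergyOf_trueCorner_upper_band (Δ₁ := ((44 : ℝ) / 25)) (Δ₂ := ((59 : ℝ) / 25)) (a₁ := ((5 : ℝ) / 4)) (a₂ := ((147 : ℝ) / 100)) (b₁ := ((31 : ℝ) / 50)) (b₂ := ((37 : ℝ) / 50)) (c₁ := ((7 : ℝ) / 50)) (c₂ := ((17 : ℝ) / 100)) (ν₁ := ((103 : ℝ) / 250)) (ν₂ := ((107 : ℝ) / 250))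
      (pU := ((18223 : ℝ) / 10000)) (qU := ((769 : ℝ) / 400)) (qT := ((10651 : ℝ) / 5000)) (Mb := ((709 : ℝ) / 200)) (Mc := (0 : ℝ)) (by norm_num) ⟨hΔl, hΔu⟩ (by norm_num) ⟨hal, hau⟩ (by norm_num) hb (by norm_num) hc (by norm_num) (by norm_num) hν (by norm_num)
      hTop.2 (by norm_num) (by norm_num) hSU.1 hQU.2 (by norm_num) (by norm_num [fsD, fsN]) (by norm_num) (by norm_num) (by norm_num [fsD, fsN]) (by norm_num) (by norm_num) (by norm_num [fsD, fsN])
    refine le_trans hup ?_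
    have hw := (fsRatio_mem_Icc_on_window_of_dopingDisc_nonpos (Δ := ((59 : ℝ) / 25)) (a := ((147 : ℝ) / 100)) (b := ((31 : ℝ) / 50)) (c := ((7 : ℝ) / 50))
      (p := ((18491 : ℝ) / 10000)) (q := ((18891 : ℝ) / 10000)) (by norm_num) (by norm_num) (by norm_num) (by norm_num) (by norm_num) (by norm_num) (by norm_num) (by norm_num [dopingDisc]) hTH).2
    refine le_trans hw ?_
    norm_num [fsRatio, fsD, fsN]

end Summit.Ventures.CertifiedManyBodySolver.Downfold.Emery
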